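import Literature.MathematicalPhysics.QuantumFieldTheory.Balaban1983to89.B1Eq324BenfattoSect5FreeStep
import Literature.MathematicalPhysics.QuantumFieldTheory.Balaban1983to89.B1Eq324BenfattoSect5TupleClustersAnchored
import Literature.MathematicalPhysics.QuantumFieldTheory.Balaban1983to89.B1Eq324BenfattoSect5FreeStepCrossMasses
import HarnessLib

/-!
# `Balaban1983to89.B1Eq324BenfattoSect5FreePerturb` — [BenfattoEtAl1978] §5 pp. 155–159, (5.11)/(5.24)/(5.34) INSIDE THE FREE
# CUMULANTS: a small, volume-spread perturbation `Y` of a volume-size Hamiltonian `X` moves `Ê₀^T(·; k)` by at most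
# `2^k·C_k·𝓜̃(Y)·M_u^{k−1}` — extensive through the small class's mass only — PROVED (the engine for the `Ψ₃` and (5.34) removals)

statement-level skeleton of published theorems with citation tags; proofs where landed; nothing here is a claim about the
Yang–Mills mass gap

WHY THIS MODULE (cell `pub-ymgap`, seat `dag-n08-b`, node N08; item (R2) engine of the `BasicLemmaPrinted` assembly map).
`…Sect5FreeStep.sum_truncatedExp_sub_eq_telescope` produces, per pavement step, the free cumulants of
`H_{Γ₁} + Σ_□(Ψ₁+Ψ₂)(□) = Ĥ_J − Σ_□Ψ₃(□)` and of `H_{Γ₁} + Σ_□(Ψ′₁+Ψ₂)(□) = H_{Γ̄₁} + (5.34)-correction`, while the iteration wants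
`Ê₀^T(Ĥ_J; k)` and `Ê₀^T(H_{Γ̄₁}; k)` ((5.24): «Ψ₃ can be eliminated … by the same argument used in eliminating H_J^{(l)}»; (5.34):
«making an error … that can be bounded by (const) e^{−(ϰ/4)b^{3/2}}|Ī|»).  Print makes these replacements in the MEASURE; in the
free cumulants they are the identity `Ê₀^T(X+Y;k) − Ê₀^T(X;k) = Σ_{f uses Y} 𝓔^T_0(f)` (`…FreeCumulants.cumulantOf_add_sub_eq_of_moments`)
followed by Appendix D anchored at a `Y`-slot with the decay measured from that slot's own anchor tessera — the sibling seat's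
`…TupleClustersAnchored.abs_ursellOf_tupleSums_condField_le_anchored_of_uniform` — and the uniform per-anchor mass bound
`…FreeStepCrossMasses.decayWeightedMass_le` at `R_A = {y}`: every other slot, even the whole-volume class `X`, costs `M_u = O(1)`.

DICTIONARY.  `X = Σ_{T_X}…`, `Y = Σ_{T_Y}…` tuple-class sums over `J` (`…Sect5Eq511.term`); `Ê₀^T(S;k) = cumulantOf (r ↦ ∫ S^r dP̂₀) k`
(= `truncatedExp (P0 …) S k`); `C_k = 2^{kD}2^{2^{kD}}K₀^{kD}`, `K₀ = max(1, C₀₀)`; `𝓜̃(Y)` the `δ`-inflated mass of `T_Y`;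
`M_u = A·e^{(δ/2)D²d}·K(δ/(2k), d)·S(ϰ/2 − (δ/2)D²√d)` (`K`, `S` as in `…FreeStepCrossMasses`).

WHAT IS PROVED (theorems only; no definition, no named fact, no `sorry`; axioms standard).
* ★★ **`abs_cumulantOf_add_sub_le`** — `|Ê₀^T(X+Y; k+1) − Ê₀^T(X; k+1)| ≤ 2^{k+1}·C_{k+1}·𝓜̃(Y)·M_u^k` for any two tuple classes,
  `0 < δ ≤ log((2d+α²)/2d)` with `ϰ/2 > (δ/2)D²√d`, `|A^n_Δ| ≤ A`, `d ≥ 1`.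

HONEST SCOPE / NOT HERE.  The instantiations (`Y = Σ_□Ψ₃(□)`: `𝓜̃ ≤ |B|·(const)e^{−(ϰ/4)v}`-type by `…Eq524`; `Y =` the (5.34)
correction; `Y = H_J^{(l)}` is the sibling seat's (R3) `…HlCumulants`) and the assembly are NOT here.  `BasicLemmaPrinted` stays
OPEN.  NOT summit progress; count-neutral for N08; nothing of [Balaban1985UV3] (41)/(47)/(5) is asserted.
-/

open MeasureTheory ProbabilityTheory Finset
open scoped BigOperators Nat

namespace Literature.MathematicalPhysics.QuantumFieldTheory.Balaban1983to89.B1Eq324BenfattoSect5FreePerturb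

open _root_.MeasureTheory _root_.ProbabilityTheory
open Literature.Probability.LatticeModels (ursellOf cumulantOf)
open Literature.MathematicalPhysics.QuantumFieldTheory
open Literature.MathematicalPhysics.QuantumFieldTheory.Balaban1983to89.B1Eq324BenfattoLemma
open Literature.MathematicalPhysics.QuantumFieldTheory.Balaban1983to89.B1Eq324BenfattoSect5Eq511 (term)
open Literature.MathematicalPhysics.QuantumFieldTheory.Balaban1983to89.B1Eq324BenfattoAppendixC2 (freeCov_nonneg)
open Literature.MathematicalPhysics.QuantumFieldTheory.Balaban1983to89.B1Eq324BenfattoSect5FreeCumulants (cumulantOf_add_sub_eq_of_moments)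
open Literature.MathematicalPhysics.QuantumFieldTheory.Balaban1983to89.B1Eq324BenfattoSect5FreeStep (tupleSum_P0_moments)
open Literature.MathematicalPhysics.QuantumFieldTheory.Balaban1983to89.B1Eq324BenfattoSect5TupleClustersAnchored
  (abs_ursellOf_tupleSums_condField_le_anchored_of_uniform)
open Literature.MathematicalPhysics.QuantumFieldTheory.Balaban1983to89.B1Eq324BenfattoSect5FreeStepCrossMasses (decayWeightedMass_le)

variable {d : ℕ} {α β : ℝ} {s D : ℕ} {κ : ℝ} {a : Coef d} {J : Finset (B1Eq324BenfattoLemma.Site d)}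

/-- **A SMALL VOLUME-SPREAD PERTURBATION INSIDE A FREE CUMULANT** ((5.11)/(5.24)/(5.34) on the cumulant side): for two tuple classes
`T_X` (any size) and `T_Y` over `J` under `P̂₀`,
`|Ê₀^T(X+Y; k+1) − Ê₀^T(X; k+1)| ≤ 2^{k+1}·2^{(k+1)D}2^{2^{(k+1)D}}K₀^{(k+1)D}·𝓜̃(Y)·M_u^k` — the colourings using `Y`
(`…FreeCumulants.cumulantOf_add_sub_eq_of_moments`), each bounded by Appendix D anchored at its `Y`-slot
(`…TupleClustersAnchored.abs_ursellOf_tupleSums_condField_le_anchored_of_uniform`) with the uniform per-anchor slot mass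
`M_u` (`…FreeStepCrossMasses.decayWeightedMass_le` at `R_A = {y}`). [cite: BenfattoEtAl1978, (5.11) p.155, (5.24) p.157, (5.34)–(5.35) p.159] -/
theorem abs_cumulantOf_add_sub_le (hα : 0 < α) (hβ : 0 < β) (hd : 0 < d) {δ A : ℝ}
    (hres : 0 < κ / 2 - δ / 2 * ((D : ℝ) ^ 2 * Real.sqrt d)) (hδ : 0 < δ) (hδle : δ ≤ Real.log ((2 * d + α ^ 2) / (2 * d)))
    (hA0 : 0 ≤ A) (hA : ∀ (p : ℕ) (Δ : Fin p → B1Eq324BenfattoLemma.Site d) (n : Fin p → ℕ), |a p Δ n| ≤ A)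
    (TX TY : (p : ℕ) → Finset (Fin p → J)) (k : ℕ) :
    |cumulantOf (fun r => ∫ z, ((∑ p ∈ Finset.Icc 1 s, ∑ Δ ∈ TX p, ∑ n ∈ admissible p D, term κ a z p Δ n) +
          (∑ p ∈ Finset.Icc 1 s, ∑ Δ ∈ TY p, ∑ n ∈ admissible p D, term κ a z p Δ n)) ^ r ∂P0 d α β) (k + 1) -
      cumulantOf (fun r => ∫ z, (∑ p ∈ Finset.Icc 1 s, ∑ Δ ∈ TX p, ∑ n ∈ admissible p D, term κ a z p Δ n) ^ r ∂P0 d α β)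
        (k + 1)| ≤
      2 ^ (k + 1) * (2 ^ ((k + 1) * D) * 2 ^ 2 ^ ((k + 1) * D) * (max 1 (freeCov d α β 0 0)) ^ ((k + 1) * D)) *
        (∑ p ∈ Finset.Icc 1 s, ∑ Δ ∈ TY p, ∑ n ∈ admissible p D,
          |a p (fun i => (Δ i : B1Eq324BenfattoLemma.Site d)) n| *
            Real.exp (-(κ / 2) * connLength fun i => (Δ i : B1Eq324BenfattoLemma.Site d)) *
            Real.exp (δ / 2 * ((D : ℝ) ^ 2 * (Real.sqrt d * connLength (fun i => (Δ i : B1Eq324BenfattoLemma.Site d)) + d)))) *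
        (A * Real.exp (δ / 2 * ((D : ℝ) ^ 2 * d)) *
          (2 / (1 - Real.exp (-(δ / (2 * ((k + 1 : ℕ) : ℝ)) / Real.sqrt d))) * Real.exp (δ / (2 * ((k + 1 : ℕ) : ℝ)) / Real.sqrt d)) ^ d *
          ∑ p ∈ Finset.Icc 1 s, ((admissible p D).card : ℝ) *
            ((2 / (1 - Real.exp (-((κ / 2 - δ / 2 * ((D : ℝ) ^ 2 * Real.sqrt d)) / (p : ℕ) / Real.sqrt d))) *
              Real.exp ((κ / 2 - δ / 2 * ((D : ℝ) ^ 2 * Real.sqrt d)) / (p : ℕ) / Real.sqrt d)) ^ d) ^ (p - 1)) ^ k := by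
  classical
  haveI : IsProbabilityMeasure (P0 d α β) := isProbabilityMeasure_P0 hα hβ
  -- names
  set C : ℝ := 2 ^ ((k + 1) * D) * 2 ^ 2 ^ ((k + 1) * D) * (max 1 (freeCov d α β 0 0)) ^ ((k + 1) * D) with hC
  set MY : ℝ := ∑ p ∈ Finset.Icc 1 s, ∑ Δ ∈ TY p, ∑ n ∈ admissible p D,
      |a p (fun i => (Δ i : B1Eq324BenfattoLemma.Site d)) n| *
        Real.exp (-(κ / 2) * connLength fun i => (Δ i : B1Eq324BenfattoLemma.Site d)) *
        Real.exp (δ / 2 * ((D : ℝ) ^ 2 * (Real.sqrt d * connLength (fun i => (Δ i : B1Eq324BenfattoLemma.Site d)) + d))) with hMY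
  set Mu : ℝ := A * Real.exp (δ / 2 * ((D : ℝ) ^ 2 * d)) *
      (2 / (1 - Real.exp (-(δ / (2 * ((k + 1 : ℕ) : ℝ)) / Real.sqrt d))) * Real.exp (δ / (2 * ((k + 1 : ℕ) : ℝ)) / Real.sqrt d)) ^ d *
      ∑ p ∈ Finset.Icc 1 s, ((admissible p D).card : ℝ) *
        ((2 / (1 - Real.exp (-((κ / 2 - δ / 2 * ((D : ℝ) ^ 2 * Real.sqrt d)) / (p : ℕ) / Real.sqrt d))) *
          Real.exp ((κ / 2 - δ / 2 * ((D : ℝ) ^ 2 * Real.sqrt d)) / (p : ℕ) / Real.sqrt d)) ^ d) ^ (p - 1) with hMu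
  have hC0 : 0 ≤ C := by positivity
  have hMY0 : 0 ≤ MY := Finset.sum_nonneg fun p _ => Finset.sum_nonneg fun Δ _ => Finset.sum_nonneg fun n _ =>
    mul_nonneg (mul_nonneg (abs_nonneg _) (Real.exp_pos _).le) (Real.exp_pos _).le
  -- the two-colour palette
  set Tc : Fin 2 → (p : ℕ) → Finset (Fin p → J) := ![TX, TY] with hTc
  set Yf : Fin 2 → (B1Eq324BenfattoLemma.Site d → ℝ) → ℝ := fun c z =>
    ∑ p ∈ Finset.Icc 1 s, ∑ Δ ∈ Tc c p, ∑ n ∈ admissible p D, term κ a z p Δ n with hYf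
  have hmo := fun c => tupleSum_P0_moments (s := s) (D := D) (κ := κ) (a := a) hα hβ (Tc c)
  have hid := cumulantOf_add_sub_eq_of_moments (μ := P0 d α β) (Y := Yf) (fun c => (hmo c).1) k (fun c p _ => (hmo c).2 p)
  have e0 : ∀ z, Yf 0 z = ∑ p ∈ Finset.Icc 1 s, ∑ Δ ∈ TX p, ∑ n ∈ admissible p D, term κ a z p Δ n := fun z => by
    simp only [hYf, hTc, Matrix.cons_val_zero]
  have e1 : ∀ z, Yf 1 z = ∑ p ∈ Finset.Icc 1 s, ∑ Δ ∈ TY p, ∑ n ∈ admissible p D, term κ a z p Δ n := fun z => by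
    simp only [hYf, hTc, Matrix.cons_val_one, Matrix.cons_val_zero]
  simp only [e0, e1] at hid
  rw [hid]
  -- each colouring using `Y`: Appendix D anchored at a `Y`-slot
  have hc₂ : 0 < δ / (2 * ((k + 1 : ℕ) : ℝ)) := by positivity
  have hterm : ∀ f ∈ univ.filter (fun f : Fin (k + 1) → Fin 2 => ∃ j, f j = 1),
      |ursellOf (fun P : Finset (Fin (k + 1)) => ∫ z, ∏ j ∈ P, Yf (f j) z ∂P0 d α β) univ| ≤ C * MY * Mu ^ k := by
    intro f hf
    obtain ⟨j₁, hj₁⟩ := (Finset.mem_filter.1 hf).2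
    have h := abs_ursellOf_tupleSums_condField_le_anchored_of_uniform (σ := Fin (k + 1)) (s := s) (D := D) (ϰ := κ) (a := a)
      hα hβ hd ∅ (fun _ => 0) (fun j => Tc (f j)) (le_max_left 1 (freeCov d α β 0 0)) (le_max_right 1 (freeCov d α β 0 0))
      (fun j p _ Δ _ i => by
        rw [condMean_empty, abs_zero]
        exact zero_le_one.trans (le_max_left _ _))
      hδ.le hδle j₁ (fun _ => Mu)
      (fun j _ y => by
        rw [Fintype.card_fin]
        have hm := decayWeightedMass_le (s := s) (D := D) (ϰ := κ) (a := a) (δ := δ) hres hc₂ hA0 hA (Tc (f j)) {y}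
          (fun z => ∑ jj, |((y jj : ℝ) - (z jj : ℝ))|) (fun z _ => ⟨y, Finset.mem_singleton_self y, le_rfl⟩)
        rw [Finset.card_singleton, Nat.cast_one, one_mul] at hm
        exact hm)
    have hprod : ∏ _j ∈ (univ : Finset (Fin (k + 1))).erase j₁, Mu = Mu ^ k := by
      rw [Finset.prod_const, Finset.card_erase_of_mem (Finset.mem_univ j₁), Finset.card_univ, Fintype.card_fin, Nat.add_sub_cancel]
    rw [condField_empty, Fintype.card_fin, hj₁, hprod] at h
    simp only [hTc, Matrix.cons_val_one, Matrix.cons_val_zero] at h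
    exact h
  refine (Finset.abs_sum_le_sum_abs _ _).trans ((Finset.sum_le_sum hterm).trans ?_)
  rw [Finset.sum_const, nsmul_eq_mul]
  have hcard : (((univ.filter (fun f : Fin (k + 1) → Fin 2 => ∃ j, f j = 1)).card : ℕ) : ℝ) ≤ 2 ^ (k + 1) := by
    have h := Finset.card_filter_le (univ : Finset (Fin (k + 1) → Fin 2)) (fun f => ∃ j, f j = 1)
    rw [Finset.card_univ, Fintype.card_fun, Fintype.card_fin, Fintype.card_fin] at h
    exact_mod_cast h
  have hKnn : ∀ t : ℝ, 0 ≤ t → 0 ≤ 2 / (1 - Real.exp (-t)) := fun t ht =>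
    div_nonneg zero_le_two (by rw [sub_nonneg, Real.exp_le_one_iff, neg_nonpos]; exact ht)
  have hMu0 : 0 ≤ Mu :=
    mul_nonneg (mul_nonneg (mul_nonneg hA0 (Real.exp_pos _).le)
      (pow_nonneg (mul_nonneg (hKnn _ (div_nonneg hc₂.le (Real.sqrt_nonneg _))) (Real.exp_pos _).le) _))
      (Finset.sum_nonneg fun p _ => mul_nonneg (Nat.cast_nonneg _) (pow_nonneg (pow_nonneg (mul_nonneg
        (hKnn _ (div_nonneg (div_nonneg hres.le (Nat.cast_nonneg _)) (Real.sqrt_nonneg _))) (Real.exp_pos _).le) _) _))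
  have h0 : 0 ≤ C * MY * Mu ^ k := mul_nonneg (mul_nonneg hC0 hMY0) (pow_nonneg hMu0 _)
  calc _ ≤ 2 ^ (k + 1) * (C * MY * Mu ^ k) := mul_le_mul_of_nonneg_right hcard h0
    _ = _ := by ring

end Literature.MathematicalPhysics.QuantumFieldTheory.Balaban1983to89.B1Eq324BenfattoSect5FreePerturb
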